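import Mathlib

/-!
HONEST FRAMING: exact (Metropolis-corrected) sampling algorithms for lattice gauge theory; figures
of merit are autocorrelation/cost numbers at stated couplings and volumes; no continuum-physics
claim.

# PerEdgeCertificate — THE RESOLVENT-LEVEL CERTIFICATE OF AN ADJACENT EDGE FROM CONJECTURE W′, THE DISCOUNTED WEAK Σ AND THE REFRESH INCOME:
# `(e−2) + C^X + C^Y + (Φ+e−1)D_n + r̃Φ ≤ (Φ+e−2)G` (lean-2 GEN-43, ours)

Venture-side (OURS).  Cell `lqcd-flow` (pub-lqcd), unit `pub-lqcd-lean-2-g43`, 2026-08-31.  Chapter AC, file 17 — the fourth lemma of the instantiation step (memo MEMO-gen43 §3 (f)),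
the algebra that turns the two typed per-edge inputs into the hypothesis `hcert` of file 16, isolated as a statement about reals.  On an adjacent edge with hub content `z`:
`C^X = (1−σ)(1−θ_z) + σ·cost(x̃)`, `C^Y = (1−σ)(1−θ_z) + σ·cost(ỹ)` (the discounted costs of all attempt counts, `j = 0` included), `G = σ·g̃` with `g̃ = x̃(★) + x̃(a) − ỹ(a)` (no gain at
`j = 0`), `D_n = σ·D'` with `D' ≤ D` a truncation of the discounted deficit, `e − 2 = −2(1−σ)(1−θ_z) − 2σ(1−θ̄)` (`1 − θ̄ = pE_{μ0}[Wθ]`, W file 6), and `Φ + e − 2 ≥ L + m`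
(`c = 2K + 2 + m`, `L ≥ 0`).  INPUTS: Conjecture W′ `cost(x̃) + cost(ỹ) ≤ L(g̃ − D)` (file 3), the weak Σ `D ≤ κg̃` with `κ(m+1) ≤ m` (file 13: `κ = K/(K²−1)`, `m = 2`), and the rate
`r̃Φ ≤ 2σ(1−θ̄)`.  OUTPUT: `(e−2) + C^X + C^Y + (Φ+e−1)D_n + r̃Φ ≤ (Φ+e−2)G`.  The key step: `(Φ+e−2)g̃ − (Φ+e−1)D ≥ L(g̃−D)` iff `(Φ+e−2−L)(g̃−D) ≥ D`, and
`(Φ+e−2−L)(g̃−D) ≥ m(1−κ)g̃ ≥ κg̃ ≥ D`.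

* **`perEdge_certificate`**.

Literature grade (cell rule): OWN, elementary; nothing cited; no new bib keys.
-/

namespace Summit.Ventures.LatticeQCDFlow.Scaling

section EdgeCertificate

/-- **THE PER-EDGE CERTIFICATE** (see the module docstring). [ours] -/
theorem perEdge_certificate {σ Φ e L m κ costX costY gt D D' θz θbar rt : ℝ}
    (hσ0 : 0 ≤ σ) (hW : costX + costY ≤ L * (gt - D)) (hSig : D ≤ κ * gt) (hκ : κ * (m + 1) ≤ m) (hm : 0 ≤ m)
    (hgt : 0 ≤ gt) (hD' : D' ≤ D)
    (hL0 : 0 ≤ L) (hL : L + m ≤ Φ + e - 2) (he : e - 2 = -2 * (1 - σ) * (1 - θz) - 2 * σ * (1 - θbar)) (hrt : rt * Φ ≤ 2 * σ * (1 - θbar)) :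
    (e - 2) + ((1 - σ) * (1 - θz) + σ * costX) + ((1 - σ) * (1 - θz) + σ * costY) + (Φ + e - 1) * (σ * D') + rt * Φ
      ≤ (Φ + e - 2) * (σ * gt) := by
  -- `κ < 1`, so `D ≤ g̃`
  have hκ1 : κ ≤ 1 := by nlinarith
  have hDg : D ≤ gt := hSig.trans (by nlinarith)
  -- the key step: `(Φ+e−2)g̃ − (Φ+e−1)D ≥ L(g̃ − D)`
  have hX : m ≤ Φ + e - 2 - L := by linarith
  have hkey : L * (gt - D) ≤ (Φ + e - 2) * gt - (Φ + e - 1) * D := by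
    -- `(Φ+e−2−L)(g̃−D) ≥ m(g̃−D) ≥ m(1−κ)g̃ ≥ κg̃ ≥ D`
    have h1 : m * (gt - D) ≤ (Φ + e - 2 - L) * (gt - D) := mul_le_mul_of_nonneg_right hX (by linarith)
    have h2 : m * (1 - κ) * gt ≤ m * (gt - D) := by nlinarith
    have h3 : κ * gt ≤ m * (1 - κ) * gt := by nlinarith
    nlinarith
  -- the truncated deficit costs at most the full one
  have hDD : (Φ + e - 1) * (σ * D') ≤ σ * ((Φ + e - 1) * D) := by
    have hΦe : 0 ≤ Φ + e - 1 := by linarith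
    nlinarith [mul_le_mul_of_nonneg_left hD' hΦe]
  -- assemble
  have hmain : σ * (costX + costY) + σ * ((Φ + e - 1) * D) ≤ σ * ((Φ + e - 2) * gt) := by
    have := mul_le_mul_of_nonneg_left (hW.trans hkey) hσ0
    nlinarith
  rw [he]
  nlinarith [hmain, hDD, hrt]

end EdgeCertificate

end Summit.Ventures.LatticeQCDFlow.Scaling
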